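import Literature.MathematicalPhysics.KineticTheory.CollisionFluxMeanBoundNonStationary
import Summits.AtomisticToContinuum.HydrodynamicLimit.Theorems.OneFlightGossipEngineCollisionActivityTailsAbnormalActivity
import Summits.AtomisticToContinuum.HydrodynamicLimit.Theorems.OneFlightGossipEngineCollisionActivityTailsAbnormalActivityStatics
import HarnessLib

/-!
# `CollisionActivityTails` (stmt-AtomisticToContinuum-13734), line `plaque-thinning-count-ld`, stub 5 (abnormal activity):
the HOT HALF from a pair-law envelope on the horizon — PROVED

Helper file (`--supports stmt-AtomisticToContinuum-13734`). With the window collision-flux inequality for a non-stationary law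
(`Literature.MathematicalPhysics.KineticTheory.CollisionFluxMeanBoundNonStationary`, p130917) and the statics of `…CollisionActivityTailsAbnormalActivityStatics` (§5–§6):

* §4 `ofReal_sum_hotAct_le` — on the good set the normalised hot activity `(N+1)⁻¹ Σ_i hotAct_i` of the window `(s, s + w]` is at
  most `(N+1)⁻¹ (σ/τ) ×` the collision sum of the hot mark over `[s, s + w]` (each collision of `i` is the ordered contact pair
  `(i, partner)`, `Σ_i 𝟙{k = i} = 1`, `|Δv_k| ≤ |v_k - v_l|` — `imp_le_relSpeed`);
* §7 `PairEnvelopeOn σ a₀ θ₀ u₀ Φ t₁ β C` (the laws at all times `r ≤ t₁` satisfy the pair-law envelope) and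
  `hotSmallOn_of_pairEnvelopeOn : 0 < σ → t < t₁ → 0 < β → PairEnvelopeOn σ a₀ θ₀ u₀ Φ t₁ β C → HotSmallOn σ a₀ θ₀ u₀ Φ t` —
  the cap `Θ` from the Gaussian tail (`4 σ³ C² I(β, Θ) ≤ η`), `N₀(τ)` from `w_N < t₁ - t`, the window inequality on `[s, s + w_N]`
  with events cut from swept tubes of mesh `w_N / M`, and the scaling `(N+1)⁻¹ (σ/τ) (N+1)² · 4 ε² w_N = 4 σ³`
  (`hsDiameter_sq_mul_window`), uniformly in `τ`.

What remains of the hot half of stub 5' is STATIC: `EnvelopeOn σ a₀ θ₀ u₀ Φ t₁ β C → PairEnvelopeOn σ a₀ θ₀ u₀ Φ t₁ β C` (order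
`k = 2` of the marginal envelope; density of the push-forward law `HardSphereFlow.lawAt_withDensity_holds`, relabelling symmetry
`HardSphereFlow.flow_comp_perm_ae`, Tonelli over the other particles `integral_mul_nthMarginal`, translation invariance of Haar
measure on `𝕋³`).

References: C. Cercignani, R. Illner, M. Pulvirenti, *The Mathematical Theory of Dilute Gases* (1994), §4.3, App. 4.A.
-/

noncomputable section

open MeasureTheory Set Filter Topology
open scoped ENNReal InnerProductSpace

namespace Summit.AtomisticToContinuum.HydrodynamicLimit.Theorems.CollisionActivityTailsAbnormalActivity

open Literature.MathematicalPhysics.KineticTheory Literature.Analysis.FluidPDE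
open Summit.AtomisticToContinuum.HydrodynamicLimit.Theorems.CollisionActivityTailsActivityDomination
  (Flow Cfg window act tdist nearCount collisionPairSum_nonneg window_pos)
open Summit.AtomisticToContinuum.HydrodynamicLimit.Theorems.CollisionActivityTailsEndpointTails (ae_mem_good_localGibbsLaw)
-- vocabulary `imp`, `relSpeed`, `hotAct`, `EnvelopeOn`, `HotSmallOn`, `HotFromEnvelope`: this namespace (file `…AbnormalActivity`, p132104)
open Summit.AtomisticToContinuum.HydrodynamicLimit.Theorems.CollisionActivityTailsAbnormalActivityStatics

/-! ## §4 The hot activity as a window collision sum of a two-velocity mark -/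

section HotBookkeeping

variable {σ : ℝ} {N : ℕ}

/-- The impulse of the first partner is at most the relative speed of the pair: `|Δv_k| = |⟪v_k - v_l, n⟫|/|n| ≤ |v_k - v_l|`
(and `0` for the junk value `n = 0` of the reflection law). -/
theorem imp_le_relSpeed (y : Cfg N) (t : ℝ) (k l : Fin (N + 1)) : imp σ N y t k l ≤ relSpeed y k l := by
  unfold imp relSpeed
  simp only [HardSphereCollisionRecord.ofConfig_postVel, HardSphereCollisionRecord.ofConfig_preVel]
  set n := (Torus.geometry (Fin 3)).sepVec (y k).1 (y l).1 with hn
  have h : (y k).2 - (reflectVel n ((y k).2, (y l).2)).1 = (⟪(y k).2 - (y l).2, n⟫_ℝ / ‖n‖ ^ 2) • n := by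
    simp only [reflectVel]
    abel
  rw [h, norm_smul, Real.norm_eq_abs, abs_div, abs_of_nonneg (sq_nonneg ‖n‖)]
  by_cases hn0 : n = 0
  · simp [hn0]
  · have hnpos : 0 < ‖n‖ := norm_pos_iff.2 hn0
    rw [div_mul_eq_mul_div, div_le_iff₀ (by positivity)]
    calc |⟪(y k).2 - (y l).2, n⟫_ℝ| * ‖n‖ ≤ ‖(y k).2 - (y l).2‖ * ‖n‖ * ‖n‖ := by
          gcongr; exact abs_real_inner_le_norm _ _
      _ = ‖(y k).2 - (y l).2‖ * ‖n‖ ^ 2 := by ring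

open scoped Classical in
/-- The hot summand of one particle is dominated by the hot mark: `ofReal (𝟙{k = i, |g| > Θ} |Δv_k|) ≤ 𝟙{k = i} hotMark`. -/
theorem ofReal_hotSummand_le (Θ : ℝ) (y : Cfg N) (t : ℝ) (i k l : Fin (N + 1)) :
    ENNReal.ofReal (if k = i ∧ ¬ relSpeed y k l ≤ Θ then imp σ N y t k l else 0) ≤
      if k = i then hotMark Θ y k l else 0 := by
  by_cases hk : k = i
  · rw [if_pos hk]
    by_cases hΘ : relSpeed y k l ≤ Θ
    · rw [if_neg (fun h => h.2 hΘ), ENNReal.ofReal_zero]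
      exact bot_le
    · have hΘ' : Θ < ‖(y k).2 - (y l).2‖ := not_le.1 hΘ
      rw [if_pos ⟨hk, hΘ⟩, hotMark, if_pos hΘ']
      exact ENNReal.ofReal_le_ofReal (imp_le_relSpeed y t k l)
  · rw [if_neg (fun h => hk h.1), if_neg hk, ENNReal.ofReal_zero]

/-- **The normalised hot activity is dominated by a window collision sum of the hot mark.** On the good set,
`ofReal((N+1)⁻¹ Σ_i hotAct_i z) ≤ ofReal((N+1)⁻¹ σ/τ) · Σ_{collision times r ∈ [s, s+w]} Σ_{k ≠ l in contact} hotMark Θ (Φ_r z) k l`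
(`τ ≥ 0`, `σ ≥ 0`; each collision of `i` is the ordered contact pair `(i, partner)`, `Σ_i 𝟙{k = i} = 1`,
`|Δv_k| ≤ |v_k - v_l|`, `(s, s+w] ⊆ [s, s+w]`). -/
theorem ofReal_sum_hotAct_le (hσ : 0 ≤ σ) (Θ : ℝ) (Φ : Flow σ N) {τ : ℝ} (hτ : 0 ≤ τ) (s : ℝ) {z : Cfg N}
    (hz : z ∈ Φ.good) :
    ENNReal.ofReal (((N : ℝ) + 1)⁻¹ * ∑ i : Fin (N + 1), hotAct Θ Φ τ s i z) ≤
      ENNReal.ofReal (((N : ℝ) + 1)⁻¹ * (σ / τ)) *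
        ∑ᶠ r ∈ collisionTimes (Torus.geometry (Fin 3)) (hsDiameter σ N) (fun t => Φ.flow t z) ∩
            Icc s (s + window τ N),
          ∑ k : Fin (N + 1), ∑ l : Fin (N + 1),
            (if k ≠ l ∧ ‖(Torus.geometry (Fin 3)).sepVec (Φ.flow r z k).1 (Φ.flow r z l).1‖ = hsDiameter σ N
              then hotMark Θ (Φ.flow r z) k l else 0) := by
  classical
  set G := Torus.geometry (Fin 3)
  set ε := hsDiameter σ N
  have hfinI : (collisionTimes G ε (fun t => Φ.flow t z) ∩ Ioc s (s + window τ N)).Finite :=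
    Φ.finite_collisionTimes_inter hz Ioc_subset_Icc_self
  have hfinC : (collisionTimes G ε (fun t => Φ.flow t z) ∩ Icc s (s + window τ N)).Finite :=
    Φ.finite_collisionTimes_inter hz Subset.rfl
  have hc : 0 ≤ ((N : ℝ) + 1)⁻¹ * (σ / τ) := mul_nonneg (inv_nonneg.2 (by positivity)) (div_nonneg hσ hτ)
  -- Step 1: pull out the constants and pass `ofReal` inside the finite sums of nonnegative terms
  have hsum : ∑ i : Fin (N + 1), hotAct Θ Φ τ s i z = σ / τ * ∑ i : Fin (N + 1),
      Φ.collisionPairSum (Ioc s (s + window τ N))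
        (fun t cfg k l => if k = i ∧ ¬ relSpeed cfg k l ≤ Θ then imp σ N cfg t k l else 0) z := by
    unfold hotAct; rw [Finset.mul_sum]
  have hnn : ∀ (i : Fin (N + 1)) t (cfg : Cfg N) k l,
      0 ≤ (if k = i ∧ ¬ relSpeed cfg k l ≤ Θ then imp σ N cfg t k l else 0) := by
    intro i t cfg k l; split_ifs; exacts [norm_nonneg _, le_rfl]
  rw [hsum, ← mul_assoc, ENNReal.ofReal_mul hc]
  gcongr
  -- Step 2: each particle's hot sum, in `ℝ≥0∞`, is at most the collision pair sum of `𝟙{k = i} hotMark` over `[s, s+w]`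
  rw [ENNReal.ofReal_sum_of_nonneg fun i _ => collisionPairSum_nonneg Φ _ (hnn i) z]
  have hstep : ∀ i : Fin (N + 1), ENNReal.ofReal (Φ.collisionPairSum (Ioc s (s + window τ N))
      (fun t cfg k l => if k = i ∧ ¬ relSpeed cfg k l ≤ Θ then imp σ N cfg t k l else 0) z) ≤
      ∑ r ∈ hfinC.toFinset, ∑ p ∈ contactPairs G ε (Φ.flow r z),
        (if p.1 = i then hotMark Θ (Φ.flow r z) p.1 p.2 else 0) := by
    intro i
    unfold HardSphereFlow.collisionPairSum
    rw [collisionPairSum_eq_finset_sum hfinI,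
      ENNReal.ofReal_sum_of_nonneg fun r _ => Finset.sum_nonneg fun p _ => hnn i _ _ _ _]
    calc ∑ r ∈ hfinI.toFinset, ENNReal.ofReal (∑ p ∈ contactPairs G ε (Φ.flow r z),
            (if p.1 = i ∧ ¬ relSpeed (Φ.flow r z) p.1 p.2 ≤ Θ then imp σ N (Φ.flow r z) r p.1 p.2 else 0))
        = ∑ r ∈ hfinI.toFinset, ∑ p ∈ contactPairs G ε (Φ.flow r z), ENNReal.ofReal
            (if p.1 = i ∧ ¬ relSpeed (Φ.flow r z) p.1 p.2 ≤ Θ then imp σ N (Φ.flow r z) r p.1 p.2 else 0) :=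
          Finset.sum_congr rfl fun r _ => ENNReal.ofReal_sum_of_nonneg fun p _ => hnn i _ _ _ _
      _ ≤ ∑ r ∈ hfinI.toFinset, ∑ p ∈ contactPairs G ε (Φ.flow r z),
            (if p.1 = i then hotMark Θ (Φ.flow r z) p.1 p.2 else 0) :=
          Finset.sum_le_sum fun r _ => Finset.sum_le_sum fun p _ => ofReal_hotSummand_le Θ _ r i p.1 p.2
      _ ≤ _ := by
          refine Finset.sum_le_sum_of_subset_of_nonneg (fun r hr => ?_) fun _ _ _ => bot_le
          rw [Set.Finite.mem_toFinset] at hr ⊢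
          exact ⟨hr.1, Ioc_subset_Icc_self hr.2⟩
  refine (Finset.sum_le_sum fun i _ => hstep i).trans (le_of_eq ?_)
  -- Step 3: swap the sums; `Σ_i 𝟙{k = i} = 1`; the inline form of the pair sum on the good set
  rw [Finset.sum_comm, finsum_mem_eq_finite_toFinset_sum _ hfinC]
  refine Finset.sum_congr rfl fun r _ => ?_
  rw [Finset.sum_comm]
  simp only [Finset.sum_ite_eq, Finset.mem_univ, if_true]
  exact sum_contactPairs_eq ((Φ.isTrajectory z hz).mem r) fun k l => hotMark Θ (Φ.flow r z) k l

end HotBookkeeping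

/-! ## §7 Assembly: the hot half from a pair-law envelope on the horizon -/

section HotAssembly

variable {σ : ℝ} {N : ℕ}

/-- **PAIR-LAW ENVELOPE ON A HORIZON**, for ONE profile triple, ONE reduced diameter and ONE flow family: the laws at all times
`r ∈ [0, t₁]` (push-forwards of the local Gibbs law under `Φ_r`) satisfy the pair-law envelope with constants `(C, β)`. This is the
STATIC residual of the hot half: it follows from `EnvelopeOn σ a₀ θ₀ u₀ Φ t₁ β C` (order `k = 2`) by the density of the push-forward
law (`HardSphereFlow.lawAt_withDensity_holds`), relabelling symmetry of the transported canonical density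
(`HardSphereFlow.flow_comp_perm_ae`), Tonelli over the other `N - 1` particles (`integral_mul_nthMarginal`) and translation invariance
of Haar measure on `𝕋³` — pure measure theory, no dynamics. -/
def PairEnvelopeOn (σ : ℝ) (a₀ θ₀ : T3 → ℝ) (u₀ : T3 → V3) (Φ : (N : ℕ) → Flow σ N) (t₁ β C : ℝ) : Prop :=
  ∀ (N : ℕ), ∀ r ∈ Set.Icc 0 t₁, PairLawEnvelope ((localGibbsLaw σ a₀ u₀ θ₀ N (Φ N)).map ((Φ N).flow r)) C β

/-- The scaling identity `ε² w = σ² τ / (N+1)` (`ε = σ ℓ`, `w = τ ℓ`, `ℓ³ = 1/(N+1)`). -/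
theorem hsDiameter_sq_mul_window (σ τ : ℝ) (N : ℕ) :
    hsDiameter σ N ^ 2 * window τ N = σ ^ 2 * τ * ((N : ℝ) + 1)⁻¹ := by
  unfold hsDiameter window
  set x : ℝ := (N : ℝ) + 1 with hx
  have hx0 : 0 < x := by positivity
  have hcast : ((N + 1 : ℕ) : ℝ) = x := by push_cast; rfl
  rw [hcast]
  calc (σ * x ^ (-(1 / 3 : ℝ))) ^ 2 * (τ * x ^ (-(1 / 3 : ℝ)))
      = σ ^ 2 * τ * (x ^ (-(1 / 3 : ℝ)) * x ^ (-(1 / 3 : ℝ)) * x ^ (-(1 / 3 : ℝ))) := by ring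
    _ = σ ^ 2 * τ * x ^ (-(1 / 3 : ℝ) + -(1 / 3 : ℝ) + -(1 / 3 : ℝ)) := by rw [← Real.rpow_add hx0, ← Real.rpow_add hx0]
    _ = σ ^ 2 * τ * x⁻¹ := by norm_num [Real.rpow_neg_one]

/-- Windows shrink: for `τ > 0` and `δ > 0`, `w_N = τ (N+1)^{-1/3} < δ` for all large `N`. -/
theorem eventually_window_lt {τ : ℝ} (δ : ℝ) (hδ : 0 < δ) : ∃ N₀ : ℕ, ∀ N : ℕ, N₀ ≤ N → window τ N < δ := by
  have h1 : Tendsto (fun N : ℕ => (N : ℝ) + 1) atTop atTop :=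
    tendsto_atTop_add_const_right _ _ tendsto_natCast_atTop_atTop
  have h2 : Tendsto (fun N : ℕ => τ * ((N : ℝ) + 1) ^ (-(1 / 3 : ℝ))) atTop (𝓝 (τ * 0)) :=
    ((tendsto_rpow_neg_atTop (by norm_num : (0 : ℝ) < 1 / 3)).comp h1).const_mul τ
  rw [mul_zero] at h2
  obtain ⟨N₀, hN₀⟩ := eventually_atTop.1 (h2.eventually (gt_mem_nhds hδ))
  exact ⟨N₀, fun N hN => hN₀ N hN⟩

/-- **THE HOT HALF FROM A PAIR-LAW ENVELOPE** (dynamics and bookkeeping, PROVED): for `σ > 0`, `t < t₁`, `β > 0`, a pair-law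
envelope on `[0, t₁]` with constants `(C, β)` gives `HotSmallOn` on the horizon `t`. Given `η`, choose the cap `Θ` with
`4 σ³ C² I(β, Θ) ≤ η` (§6); given `τ`, choose `N₀(τ)` with `w_N < t₁ - t` (windows fit below `t₁`); then for `N ≥ N₀` and `s ≤ t` the
window inequality of §1 on `[s, s + w_N]` — marks `hotMark Θ`, events cut from the swept tubes of mesh `w_N/M` (`exists_sweptTube`),
static one-window bounds `C² · 4ε² (w_N/M) · I(β, Θ)` per ordered pair under every law at a time of the window (§5) — yields a measurable
majorant of the normalised hot activity (§4) of mean `≤ (N+1)⁻¹ (σ/τ) · (N+1)² · C² · 4 ε² w_N · I(β, Θ) = 4 σ³ C² I(β, Θ) ≤ η`. -/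
theorem hotSmallOn_of_pairEnvelopeOn (hσ : 0 < σ) {a₀ θ₀ : T3 → ℝ} {u₀ : T3 → V3} {Φ : (N : ℕ) → Flow σ N} {t t₁ β C : ℝ}
    (htt₁ : t < t₁) (hβ : 0 < β) (hPE : PairEnvelopeOn σ a₀ θ₀ u₀ Φ t₁ β C) :
    HotSmallOn σ a₀ θ₀ u₀ Φ t := by
  classical
  intro η hη
  -- the cap
  set a : ℝ := 4 * σ ^ 3 * C ^ 2 with ha
  have ha0 : 0 ≤ a := by positivity
  have hδ : (0 : ℝ≥0∞) < ENNReal.ofReal (η / (a + 1)) := ENNReal.ofReal_pos.2 (by positivity)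
  obtain ⟨Θ, hΘ, hIΘ⟩ := exists_hotFluxIntegral_le hβ hδ
  have hfinal : ENNReal.ofReal a * hotFluxIntegral β Θ ≤ ENNReal.ofReal η := by
    calc ENNReal.ofReal a * hotFluxIntegral β Θ ≤ ENNReal.ofReal a * ENNReal.ofReal (η / (a + 1)) := by gcongr
      _ = ENNReal.ofReal (a * (η / (a + 1))) := (ENNReal.ofReal_mul ha0).symm
      _ ≤ ENNReal.ofReal η := ENNReal.ofReal_le_ofReal (by
          rw [mul_div_assoc']; exact div_le_of_le_mul₀ (by positivity) hη.le (by nlinarith))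
  refine ⟨Θ, hΘ, fun τ hτ => ?_⟩
  -- the windows fit below `t₁`
  obtain ⟨N₀, hN₀⟩ := eventually_window_lt (τ := τ) (t₁ - t) (by linarith)
  refine ⟨N₀, fun N hN s hs => ?_⟩
  set w : ℝ := window τ N with hwdef
  have hw : 0 < w := window_pos hτ N
  have hwt : w < t₁ - t := hN₀ N hN
  set ε : ℝ := hsDiameter σ N with hεdef
  have hε : 0 < ε := hsDiameter_pos hσ N
  set P : Measure (Cfg N) := localGibbsLaw σ a₀ u₀ θ₀ N (Φ N) with hP
  set I : ℝ≥0∞ := hotFluxIntegral β Θ with hI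
  -- the swept tubes of mesh `w / M` and the window events cut from them
  have htube : ∀ M : ℕ, ∃ S : V3 → Set V3, MeasurableSet {q : V3 × V3 | q.1 ∈ S q.2} ∧
      (∀ u, volume (S u) ≤ ENNReal.ofReal (4 * ε ^ 2 * (w / M) * ‖u‖)) ∧
      ∀ (u r : V3) (s : ℝ), ε ≤ ‖r‖ → s ∈ Icc 0 (w / M) → ‖r + s • u‖ = ε → r ∈ S u :=
    fun M => exists_sweptTube hε (div_nonneg hw.le (Nat.cast_nonneg M))
  choose S hSm hSvol hS using htube
  set E : ℕ → Fin (N + 1) → Fin (N + 1) → Set (Cfg N) := fun M k l => windowEvent (S M) k l with hE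
  set n : ℝ≥0∞ := ((N + 1 : ℕ) : ℝ≥0∞) with hn
  set B : ℕ → ℝ≥0∞ := fun M => n * n * (ENNReal.ofReal (C ^ 2) * (ENNReal.ofReal (4 * ε ^ 2 * (w / M)) * I)) with hB
  -- the static one-window bounds under the laws at the times of the window
  have hBle : ∀ (M : ℕ), ∀ r ∈ Icc s (s + w),
      ∫⁻ x, ∑ k : Fin (N + 1), ∑ l : Fin (N + 1),
        (if k ≠ l then (E M k l).indicator (fun x => hotMark Θ x k l) x else 0) ∂(P.map ((Φ N).flow r)) ≤ B M := by
    intro M r hr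
    have hr' : r ∈ Icc 0 t₁ := ⟨hs.1.trans hr.1, by linarith [hr.2, hs.2]⟩
    have hPL := hPE N r hr'
    have hεh : 0 ≤ 4 * ε ^ 2 * (w / M) := by positivity
    have hterm : ∀ k l : Fin (N + 1), ∫⁻ x, (if k ≠ l then (E M k l).indicator (fun x => hotMark Θ x k l) x else 0)
        ∂(P.map ((Φ N).flow r)) ≤ ENNReal.ofReal (C ^ 2) * (ENNReal.ofReal (4 * ε ^ 2 * (w / M)) * I) := by
      intro k l
      by_cases hkl : k ≠ l
      · simp only [if_pos hkl]
        exact lintegral_windowEvent_hotMark_le hPL hkl hεh (hSm M) (hSvol M) Θ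
      · simp only [if_neg hkl, lintegral_zero, zero_le]
    have hmeas : ∀ k l : Fin (N + 1), Measurable fun x : Cfg N =>
        (if k ≠ l then (E M k l).indicator (fun x => hotMark Θ x k l) x else 0) := by
      intro k l
      by_cases hkl : k ≠ l
      · simp only [if_pos hkl]; exact (measurable_hotMark Θ k l).indicator (measurableSet_windowEvent (hSm M) k l)
      · simp only [if_neg hkl]; exact measurable_const
    calc _ = ∑ k : Fin (N + 1), ∑ l : Fin (N + 1), ∫⁻ x, (if k ≠ l then (E M k l).indicator (fun x => hotMark Θ x k l) x else 0)
          ∂(P.map ((Φ N).flow r)) := by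
          rw [lintegral_finsetSum _ fun k _ => Finset.measurable_sum _ fun l _ => hmeas k l]
          exact Finset.sum_congr rfl fun k _ => lintegral_finsetSum _ fun l _ => hmeas k l
      _ ≤ ∑ _k : Fin (N + 1), ∑ _l : Fin (N + 1), ENNReal.ofReal (C ^ 2) * (ENNReal.ofReal (4 * ε ^ 2 * (w / M)) * I) :=
          Finset.sum_le_sum fun k _ => Finset.sum_le_sum fun l _ => hterm k l
      _ = B M := by
          simp only [Finset.sum_const, Finset.card_univ, Fintype.card_fin, nsmul_eq_mul, hB, hn]; ring
  -- the window inequality: a measurable majorant of the hot-mark collision sum over `[s, s + w]`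
  obtain ⟨g, hgm, hdom, hint⟩ := exists_measurable_majorant_collisionSum_of_forall_le (Φ N) P hw s
    (fun x k l => hotMark Θ x k l) E (fun M k l => measurableSet_windowEvent (hSm M) k l)
    (fun M k l hkl x hx t' ht' hc => mem_windowEvent_of_contact (hS M) hkl hx ht' hc)
    (fun _ x k l => hotMark Θ x k l) (fun _ k l => measurable_hotMark Θ k l)
    (fun M k l _ x _ t' _ _ => (hotMark_freeFlight Θ (-t') x k l).le) B hBle
  -- `liminf_M M · B M = (N+1)² C² · 4 ε² w · I`
  set L : ℝ≥0∞ := n * n * (ENNReal.ofReal (C ^ 2) * (ENNReal.ofReal (4 * ε ^ 2 * w) * I)) with hL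
  have hMB : ∀ M : ℕ, 1 ≤ M → (M : ℝ≥0∞) * B M = L := by
    intro M hM
    have hM0 : (0 : ℝ) < M := by exact_mod_cast hM
    have hkey : (M : ℝ≥0∞) * ENNReal.ofReal (4 * ε ^ 2 * (w / M)) = ENNReal.ofReal (4 * ε ^ 2 * w) := by
      rw [← ENNReal.ofReal_natCast, ← ENNReal.ofReal_mul (Nat.cast_nonneg M)]
      congr 1; field_simp
    rw [hB, hL, ← hkey]; ring
  have hlim : liminf (fun M : ℕ => (M : ℝ≥0∞) * B M) atTop ≤ L :=
    liminf_le_of_frequently_le' (((eventually_ge_atTop 1).mono fun M hM => (hMB M hM).le).frequently)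
  -- the constants: `(N+1)⁻¹ (σ/τ) · (N+1)² C² · 4 ε² w = 4 σ³ C²`
  set c₁ : ℝ≥0∞ := ENNReal.ofReal (((N : ℝ) + 1)⁻¹ * (σ / τ)) with hc₁
  have hconst : c₁ * L = ENNReal.ofReal a * I := by
    have hn' : n = ENNReal.ofReal ((N : ℝ) + 1) := by
      rw [hn, ← ENNReal.ofReal_natCast]; push_cast; rfl
    have h1 : 0 ≤ ((N : ℝ) + 1)⁻¹ * (σ / τ) := by positivity
    have h2 : (0 : ℝ) ≤ (N : ℝ) + 1 := by positivity
    have hreal : ((N : ℝ) + 1)⁻¹ * (σ / τ) * ((N : ℝ) + 1) * ((N : ℝ) + 1) * C ^ 2 * (4 * ε ^ 2 * w) = a := by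
      have hsc : ε ^ 2 * w = σ ^ 2 * τ * ((N : ℝ) + 1)⁻¹ := hsDiameter_sq_mul_window σ τ N
      have hN1 : (N : ℝ) + 1 ≠ 0 := by positivity
      calc ((N : ℝ) + 1)⁻¹ * (σ / τ) * ((N : ℝ) + 1) * ((N : ℝ) + 1) * C ^ 2 * (4 * ε ^ 2 * w)
          = 4 * C ^ 2 * (σ / τ) * (((N : ℝ) + 1)⁻¹ * ((N : ℝ) + 1)) * ((N : ℝ) + 1) * (ε ^ 2 * w) := by ring
        _ = a := by rw [hsc, inv_mul_cancel₀ hN1, ha]; field_simp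
    calc c₁ * L = c₁ * n * n * ENNReal.ofReal (C ^ 2) * ENNReal.ofReal (4 * ε ^ 2 * w) * I := by rw [hL]; ring
      _ = ENNReal.ofReal (((N : ℝ) + 1)⁻¹ * (σ / τ) * ((N : ℝ) + 1) * ((N : ℝ) + 1) * C ^ 2 * (4 * ε ^ 2 * w)) * I := by
          rw [hc₁, hn', ← ENNReal.ofReal_mul h1, ← ENNReal.ofReal_mul (by positivity),
            ← ENNReal.ofReal_mul (by positivity), ← ENNReal.ofReal_mul (by positivity)]
      _ = ENNReal.ofReal a * I := by rw [hreal]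
  -- the measurable majorant of the normalised hot activity
  refine ⟨fun z => c₁ * g z, hgm.const_mul c₁, ?_, ?_⟩
  · filter_upwards [ae_mem_good_localGibbsLaw σ a₀ θ₀ u₀ N (Φ N)] with z hz
    exact (ofReal_sum_hotAct_le hσ.le Θ (Φ N) hτ.le s hz).trans (mul_le_mul' le_rfl (hdom z hz))
  · calc ∫⁻ z, c₁ * g z ∂P = c₁ * ∫⁻ z, g z ∂P := lintegral_const_mul c₁ hgm
      _ ≤ c₁ * L := mul_le_mul' le_rfl (hint.trans hlim)
      _ = ENNReal.ofReal a * I := hconst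
      _ ≤ ENNReal.ofReal η := hfinal

end HotAssembly

/-! ## §8 Registered form and the hot half from a pair-envelope plumbing -/

/-- **Registered helper sub-goal `stub_hotSmallOn_of_pairEnvelopeOn`** (line `plaque-thinning-count-ld`, stub 5, hot half): closed form of
`hotSmallOn_of_pairEnvelopeOn`. -/
theorem stub_hotSmallOn_of_pairEnvelopeOn : ∀ {σ : ℝ}, 0 < σ → ∀ {a₀ θ₀ : T3 → ℝ} {u₀ : T3 → V3} {Φ : (N : ℕ) → Flow σ N} {t t₁ β C : ℝ}, t < t₁ → 0 < β → PairEnvelopeOn σ a₀ θ₀ u₀ Φ t₁ β C → HotSmallOn σ a₀ θ₀ u₀ Φ t :=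
  fun hσ _ _ _ _ _ _ _ _ htt₁ hβ hPE => hotSmallOn_of_pairEnvelopeOn hσ htt₁ hβ hPE

/-- **The HOT HALF of stub 5 from the marginal-to-pair plumbing**: if every envelope on a horizon yields the pair-law envelope of the laws at its times
(the landed `…Theorems.CollisionActivityTailsEnvelopePlumbing.stub_labelEnvelopeOn`, p131788, proves this for its verbatim copy of `PairEnvelopeOn`),
then `HotFromEnvelope` holds with `σ₅ = 1/2`. -/
theorem hotFromEnvelope_of_pairEnvelope
    (h : ∀ (a₀ θ₀ : T3 → ℝ) (u₀ : T3 → V3), Continuous a₀ → Continuous θ₀ → Continuous u₀ →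
      (∀ x, 0 < a₀ x) → (∀ x, 0 < θ₀ x) → ∀ σ : ℝ, 0 < σ → σ < 2⁻¹ →
      ∀ (Φ : (N : ℕ) → Flow σ N) (t₁ β C : ℝ), 0 ≤ C →
        EnvelopeOn σ a₀ θ₀ u₀ Φ t₁ β C → PairEnvelopeOn σ a₀ θ₀ u₀ Φ t₁ β C) :
    HotFromEnvelope := by
  intro a₀ θ₀ u₀ ha hθ hu ha0 hθ0
  refine ⟨2⁻¹, by norm_num, fun σ hσ hσlt Φ t t₁ β C _ htt₁ hβ hC hE => ?_⟩
  exact hotSmallOn_of_pairEnvelopeOn hσ htt₁ hβ (h a₀ θ₀ u₀ ha hθ hu ha0 hθ0 σ hσ hσlt Φ t₁ β C hC hE)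

end Summit.AtomisticToContinuum.HydrodynamicLimit.Theorems.CollisionActivityTailsAbnormalActivity

end
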